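import Mathlib
import HarnessLib
import Summits.NavierStokesRegularity.NavierStokesRegularity.Theorems.PoloidalWindowDoorPoloidalWindowRigidityZShockAutonomySlab
import Summits.NavierStokesRegularity.NavierStokesRegularity.Theorems.PoloidalWindowDoorPoloidalWindowRigidityZShockThickInstants

/-!
# Crux K2 `PoloidalWindowRigidity` (stmt-NavierStokesRegularity-19708), line `z_shock` — the (TH)-INSTANT / CONSTANT-SLOPE RESIDUE OF THE
# DECIDING STUB IS ABSORBED BY THE REGISTERED MIXED-POCKET STUB: `stub_zShockThickAut` ⟸ `hGN` + `stub_mixedPocketThick`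

`--supports stmt-NavierStokesRegularity-19708 --as helper` (leafhand-ns-poloidalwindowdoor-3 g16, cell decomp-ns, 2026-09-01).  Def-free;
pure case analysis + composition of landed theorems.  **No stub and no summit is closed by this file; Navier–Stokes regularity is NOT
proved here (rung 0).**

THE RESIDUE.  g12's kernel reduction `…ZShockAutReduction.stub_zShockThickAut_of_sliceLiouville_of_thInstant` (and its variants
`…ZShockThInstantSlope.stub_zShockThickAut_of_sliceLiouville_of_constSlope`, `…ZShockMinorsSplit.autM_of_sliceLiouville_of_constSlope`,
g13's `…ZShockSlabMinorsSplit`) writes the deciding stub of skeleton `z_shock` (sha16 c3e8eee2) as the CLASS-FREE slice Liouville statement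
`hGN` (XL, not in print) PLUS a named residue: the densely hyperbolic time `t₀ = z₀.1` handed over by the stub may be a «(TH)-instant»
(genuine-nonlinearity defect `D_b(t₀,·) ≡ 0`, equivalently a GLOBAL constant negative slope law on the slice), on which the kinematic lever
is INHABITED (`…ZShockAutReductionTight.constSlope_slice_inhabited`); every census since (g12–g15) books this residue (`hTH` / `hTV₀` /
`hTV₀M`) as «needs the (TH)-column dynamics».  `…ZShockThickInstants` bounds it (in a THICK window the (TH)-instants are isolated in time)
and records as planner-facing remark that «whether dense hyperbolicity persists to the nearby times is NOT provided by the stub».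

THIS FILE removes the residue WITHOUT any dynamics, by changing the slice instead of attacking the instant: the conclusion
`¬ IsBackwardSingularPoint v 0` does not depend on `z₀`, the autonomy minors propagate from `z₀` to the whole backward slab
(`…ZShockAutonomySlab.minors_eq_zero_on_slab_of_class_autonomy`), and therefore EITHER some window point `z₁` carries a densely hyperbolic
slice that is NOT a (TH)-instant — then `hGN` applies to the slice `v(z₁.1, ·)` exactly as in g12's proof — OR every densely hyperbolic
window time is a (TH)-instant; in the latter case the isolation of (TH)-instants (`…ZShockThickInstants.th_instants_isolated_of_class`, with
`…ZShockThInstantSlope.constSlope_of_gnDefect_eq_zero` to pass from the defect form to the constant-slope form) produces a product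
SUB-WINDOW `(t₀, t₀ + ε) × B` NONE of whose times is densely hyperbolic, i.e. a window satisfying the `hpocket` clause of the REGISTERED
residue stub `stub_mixedPocketThick` VERBATIM (all other window clauses restrict to sub-windows).

* `false_of_sliceLiouville_of_gnPoint` — the GN branch of g12's proof, made reusable AT AN ARBITRARY SLAB TIME `t`: class binders +
  autonomy on some open `W₁` of the slab + a densely hyperbolic slice `t` with one hyperbolic, one twisting and one genuinely nonlinear point
  ⟹ `False` from `hGN`.
* `exists_pocketWindow_of_thInstants` — the sub-window construction of the second case.
* (sequel `…ZShockAutOfSliceLiouville`, same hand) ★ `stub_zShockThickAut_of_sliceLiouville_of_mixedPocket` — the registered type of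
  `stub_zShockThickAut` VERBATIM ⟸ `hGN` ∧ `hPocket` (`hPocket` = the registered type of `stub_mixedPocketThick` VERBATIM), superseding
  `…of_sliceLiouville_of_thInstant` (the hypothesis `hTH` is gone, replaced by a stub the skeleton ALREADY carries); and
  `hyperbolicThick_of_sliceLiouville` — `mixed_type`'s `stub_hyperbolicThick` (`hHT`) ⟸ `hGN` ∧ `stub_zShockThickMod` ∧ `stub_mixedPocketThick`
  with NO new residue, so a planner may register the class-free `stub_sliceLiouville := hGN` as the deciding stub of `z_shock`.

HONEST LABEL: bookkeeping in the kernel (one named residue of the repair census eliminated); closes no stub; `hGN` is XL. [folklore]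
-/

namespace Summit.NavierStokesRegularity.NavierStokesRegularity.Theorems.PoloidalWindowDoorPoloidalWindowRigidityZShockThInstantAbsorbed

-- the problem directory repeats the summit name (`NavierStokesRegularity/NavierStokesRegularity`)
set_option linter.dupNamespace false

open Set Filter Topology Function Metric
open scoped RealInnerProductSpace InnerProductSpace
open Literature.Analysis Literature.Analysis.FluidPDE
open Summit.NavierStokesRegularity.NavierStokesRegularity.Theorems.LocalSineTubeDoorProfileAlignedWindowRigidityAncient
open Summit.NavierStokesRegularity.NavierStokesRegularity.Theorems.PoloidalWindowDoorPoloidalWindowRigidityClassRate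
open Summit.NavierStokesRegularity.NavierStokesRegularity.Theorems.PoloidalWindowDoorPoloidalWindowRigidityZShockEllipticPocket
open Summit.NavierStokesRegularity.NavierStokesRegularity.Theorems.PoloidalWindowDoorPoloidalWindowRigidityZShockThInstantSlope
open Summit.NavierStokesRegularity.NavierStokesRegularity.Theorems.PoloidalWindowDoorPoloidalWindowRigidityZShockAutonomySlab
open Summit.NavierStokesRegularity.NavierStokesRegularity.Theorems.PoloidalWindowDoorPoloidalWindowRigidityZShockThickInstants

/-- **The GN branch of the kernel reduction at an ARBITRARY slab time.**  For a class profile whose slope is a local function of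
`(t, v₂)` on some open set `W₁` of the backward slab (the autonomy clause of the deciding stub), every slice `v(t,·)`, `t < 0`, which is
densely hyperbolic and carries one strictly hyperbolic point, one twisting point and one genuinely nonlinear point (defect `D_b ≠ 0`)
contradicts the class-free slice Liouville statement `hGN`: slice analyticity, Type-I bounds on the slice and its gradient, the wedge law,
the autonomy minors on the WHOLE slab (`…ZShockAutonomySlab.minors_eq_zero_on_slab_of_class_autonomy`) and «no strictly elliptic point»
(`…ZShockEllipticPocket.hypDiscriminant_nonpos_of_dense`) are its inputs.  (g12's `…ZShockAutReduction` is the case `t = z₀.1`.) [folklore] -/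
theorem false_of_sliceLiouville_of_gnPoint
    (hGN : ∀ (u : EuclideanSpace ℝ (Fin 3) → EuclideanSpace ℝ (Fin 3)),
      AnalyticOnNhd ℝ u Set.univ →
      (∃ M : ℝ, ∀ x, ‖u x‖ ≤ M) →
      (∃ M₁ : ℝ, ∀ x, ‖fderiv ℝ u x‖ ≤ M₁) →
      Literature.Analysis.FluidPDE.VectorCalculus.IsDivFree u →
      (∀ y, ⟪Literature.Analysis.FluidPDE.curl u y, EuclideanSpace.single 2 1⟫_ℝ = 0) →
      (∀ y, fderiv ℝ u y (EuclideanSpace.single 2 1) 0 * fderiv ℝ u y (EuclideanSpace.single 1 1) 2 -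
        fderiv ℝ u y (EuclideanSpace.single 2 1) 1 * fderiv ℝ u y (EuclideanSpace.single 0 1) 2 = 0) →
      (∀ b : Fin 3, b ≠ 2 → ∀ x p q : EuclideanSpace ℝ (Fin 3),
        (fderiv ℝ u x (EuclideanSpace.single b 1) 2 *
              fderiv ℝ (fun y => fderiv ℝ u y (EuclideanSpace.single 2 1) b) x p -
            fderiv ℝ u x (EuclideanSpace.single 2 1) b *
              fderiv ℝ (fun y => fderiv ℝ u y (EuclideanSpace.single b 1) 2) x p) *
            fderiv ℝ (fun y => u y 2) x q -
          (fderiv ℝ u x (EuclideanSpace.single b 1) 2 *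
              fderiv ℝ (fun y => fderiv ℝ u y (EuclideanSpace.single 2 1) b) x q -
            fderiv ℝ u x (EuclideanSpace.single 2 1) b *
              fderiv ℝ (fun y => fderiv ℝ u y (EuclideanSpace.single b 1) 2) x q) *
            fderiv ℝ (fun y => u y 2) x p = 0) →
      (∀ y, fderiv ℝ u y (EuclideanSpace.single 2 1) 0 * fderiv ℝ u y (EuclideanSpace.single 0 1) 2 +
        fderiv ℝ u y (EuclideanSpace.single 2 1) 1 * fderiv ℝ u y (EuclideanSpace.single 1 1) 2 ≤ 0) →
      (∃ y, fderiv ℝ u y (EuclideanSpace.single 2 1) 0 * fderiv ℝ u y (EuclideanSpace.single 0 1) 2 +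
        fderiv ℝ u y (EuclideanSpace.single 2 1) 1 * fderiv ℝ u y (EuclideanSpace.single 1 1) 2 < 0) →
      (∃ y, fderiv ℝ (fun x => fderiv ℝ u x (EuclideanSpace.single 2 1) 2) y (EuclideanSpace.single 0 1) *
            fderiv ℝ u y (EuclideanSpace.single 1 1) 2 -
          fderiv ℝ (fun x => fderiv ℝ u x (EuclideanSpace.single 2 1) 2) y (EuclideanSpace.single 1 1) *
            fderiv ℝ u y (EuclideanSpace.single 0 1) 2 ≠ 0) →
      (∃ b : Fin 3, b ≠ 2 ∧ ∃ x p : EuclideanSpace ℝ (Fin 3),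
        fderiv ℝ u x (EuclideanSpace.single b 1) 2 *
            fderiv ℝ (fun y => fderiv ℝ u y (EuclideanSpace.single 2 1) b) x p -
          fderiv ℝ u x (EuclideanSpace.single 2 1) b *
            fderiv ℝ (fun y => fderiv ℝ u y (EuclideanSpace.single b 1) 2) x p ≠ 0) →
      False)
    {C : ℝ} {v : ℝ → EuclideanSpace ℝ (Fin 3) → EuclideanSpace ℝ (Fin 3)}
    (hrate : Literature.Analysis.FluidPDE.HasTypeITimeDecay C v)
    (hcont : ContinuousOn (Function.uncurry v) (Set.Iio (0 : ℝ) ×ˢ Set.univ))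
    (hmild : ∀ s t : ℝ, s < t → t < 0 → ∀ x, v t x =
      Literature.Analysis.UnboundedOperators.heatExtension (v s) (t - s) x -
        Literature.Analysis.FluidPDE.oseenDuhamel 1 s v v t x)
    (hdiv : ∀ t < 0, Literature.Analysis.FluidPDE.VectorCalculus.IsDivFree (v t))
    (hpol : ∀ s < 0, ∀ y, ⟪Literature.Analysis.FluidPDE.curl (v s) y, EuclideanSpace.single 2 1⟫_ℝ = 0)
    {W₁ : Set (ℝ × EuclideanSpace ℝ (Fin 3))} (hW₁ : IsOpen W₁) (hW₁s : W₁ ⊆ Set.Iio (0 : ℝ) ×ˢ Set.univ)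
    (hW₁ne : W₁.Nonempty) {g : ℝ → ℝ → ℝ}
    (haut : ∀ z ∈ W₁, ∀ b : Fin 3, b ≠ 2 →
      fderiv ℝ (v z.1) z.2 (EuclideanSpace.single 2 1) b =
        g z.1 (v z.1 z.2 2) * fderiv ℝ (v z.1) z.2 (EuclideanSpace.single b 1) 2)
    {t : ℝ} (ht : t < 0)
    (hD : Dense {y : EuclideanSpace ℝ (Fin 3) |
      fderiv ℝ (v t) y (EuclideanSpace.single 2 1) 0 * fderiv ℝ (v t) y (EuclideanSpace.single 0 1) 2 +
        fderiv ℝ (v t) y (EuclideanSpace.single 2 1) 1 * fderiv ℝ (v t) y (EuclideanSpace.single 1 1) 2 < 0})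
    (hhyp : ∃ y, fderiv ℝ (v t) y (EuclideanSpace.single 2 1) 0 * fderiv ℝ (v t) y (EuclideanSpace.single 0 1) 2 +
        fderiv ℝ (v t) y (EuclideanSpace.single 2 1) 1 * fderiv ℝ (v t) y (EuclideanSpace.single 1 1) 2 < 0)
    (htw : ∃ y, fderiv ℝ (fun x => fderiv ℝ (v t) x (EuclideanSpace.single 2 1) 2) y (EuclideanSpace.single 0 1) *
          fderiv ℝ (v t) y (EuclideanSpace.single 1 1) 2 -
        fderiv ℝ (fun x => fderiv ℝ (v t) x (EuclideanSpace.single 2 1) 2) y (EuclideanSpace.single 1 1) *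
          fderiv ℝ (v t) y (EuclideanSpace.single 0 1) 2 ≠ 0)
    (hgn : ∃ b : Fin 3, b ≠ 2 ∧ ∃ x p : EuclideanSpace ℝ (Fin 3),
      fderiv ℝ (v t) x (EuclideanSpace.single b 1) 2 *
          fderiv ℝ (fun y => fderiv ℝ (v t) y (EuclideanSpace.single 2 1) b) x p -
        fderiv ℝ (v t) x (EuclideanSpace.single 2 1) b *
          fderiv ℝ (fun y => fderiv ℝ (v t) y (EuclideanSpace.single b 1) 2) x p ≠ 0) :
    False := by
  -- slice analyticity
  have han : AnalyticOnNhd ℝ (v t) univ :=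
    analyticOnNhd_slice hcont (bdd_of_hasTypeITimeDecay hrate) hmild ht
  -- boundedness of the slice and of its gradient (Type-I rate; local smoothing)
  have hbd : ∃ M : ℝ, ∀ x, ‖v t x‖ ≤ M := ⟨C / Real.sqrt (-t), fun x => hrate t ht x⟩
  have hgrad : ∃ M₁ : ℝ, ∀ x, ‖fderiv ℝ (v t) x‖ ≤ M₁ := by
    obtain ⟨C₁, hC₁⟩ := exists_fderiv_rate_of_class hrate hcont hmild
    exact ⟨C₁ / (-t), fun x => hC₁ t ht x⟩
  -- the wedge law on the slice
  have hwedge : ∀ y : EuclideanSpace ℝ (Fin 3),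
      fderiv ℝ (v t) y (EuclideanSpace.single 2 1) 0 * fderiv ℝ (v t) y (EuclideanSpace.single 1 1) 2 -
        fderiv ℝ (v t) y (EuclideanSpace.single 2 1) 1 * fderiv ℝ (v t) y (EuclideanSpace.single 0 1) 2 = 0 :=
    fun y => wedge_slice_of_class hrate hcont hmild hdiv hpol ht y
  -- L0(a) in space–time: the autonomy minors vanish on the whole slab, in particular on the slice `t`
  have hminors : ∀ b : Fin 3, b ≠ 2 → ∀ x p q' : EuclideanSpace ℝ (Fin 3),
      (fderiv ℝ (v t) x (EuclideanSpace.single b 1) 2 *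
            fderiv ℝ (fun y => fderiv ℝ (v t) y (EuclideanSpace.single 2 1) b) x p -
          fderiv ℝ (v t) x (EuclideanSpace.single 2 1) b *
            fderiv ℝ (fun y => fderiv ℝ (v t) y (EuclideanSpace.single b 1) 2) x p) *
          fderiv ℝ (fun y => v t y 2) x q' -
        (fderiv ℝ (v t) x (EuclideanSpace.single b 1) 2 *
            fderiv ℝ (fun y => fderiv ℝ (v t) y (EuclideanSpace.single 2 1) b) x q' -
          fderiv ℝ (v t) x (EuclideanSpace.single 2 1) b *
            fderiv ℝ (fun y => fderiv ℝ (v t) y (EuclideanSpace.single b 1) 2) x q') *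
          fderiv ℝ (fun y => v t y 2) x p = 0 :=
    fun b hb x p q' => minors_eq_zero_on_slab_of_class_autonomy C v hrate hcont hmild hW₁ hW₁s hW₁ne haut ht hb x p q'
  -- no strictly elliptic point on the slice
  have hE : ∀ y : EuclideanSpace ℝ (Fin 3),
      fderiv ℝ (v t) y (EuclideanSpace.single 2 1) 0 * fderiv ℝ (v t) y (EuclideanSpace.single 0 1) 2 +
        fderiv ℝ (v t) y (EuclideanSpace.single 2 1) 1 * fderiv ℝ (v t) y (EuclideanSpace.single 1 1) 2 ≤ 0 :=
    hypDiscriminant_nonpos_of_dense hrate hcont hmild ht hD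
  exact hGN (v t) han hbd hgrad (hdiv t ht) (hpol t ht) hwedge hminors hE hhyp htw hgn

/-- **The sub-window of the second case.**  Class binders, a window `W` of the backward slab on which `∇ₕv₂ ≠ 0`, which is strictly
hyperbolic and THICK, a window point `z₀`, and the case hypothesis «every densely hyperbolic window time is a (TH)-instant» (the
genuine-nonlinearity defect `D_b(z.1, ·)` vanishes identically for every `z ∈ W` whose slice is densely hyperbolic) ⟹ there is an open
nonempty sub-window `W' ⊆ W` NONE of whose times carries a densely hyperbolic slice (the `hpocket` clause of `stub_mixedPocketThick`).
Construction: a product ball `B_t × B_x ⊆ W` round `z₀`; by `th_instants_isolated_of_class` all times `s ≠ z₀.1` close to `z₀.1` are NOT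
constant-slope on `B_x`; by `constSlope_of_gnDefect_eq_zero` a time whose defect vanishes identically IS (globally) constant-slope; so
`W' = (z₀.1, z₀.1 + ε) × B_x` has no densely hyperbolic time. [folklore] -/
theorem exists_pocketWindow_of_thInstants (C : ℝ) (v : ℝ → EuclideanSpace ℝ (Fin 3) → EuclideanSpace ℝ (Fin 3))
    (hrate : Literature.Analysis.FluidPDE.HasTypeITimeDecay C v)
    (hcont : ContinuousOn (Function.uncurry v) (Set.Iio (0 : ℝ) ×ˢ Set.univ))
    (hmild : ∀ s t : ℝ, s < t → t < 0 → ∀ x, v t x =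
      Literature.Analysis.UnboundedOperators.heatExtension (v s) (t - s) x -
        Literature.Analysis.FluidPDE.oseenDuhamel 1 s v v t x)
    (hdiv : ∀ t < 0, Literature.Analysis.FluidPDE.VectorCalculus.IsDivFree (v t))
    (hpol : ∀ s < 0, ∀ y, ⟪Literature.Analysis.FluidPDE.curl (v s) y, EuclideanSpace.single 2 1⟫_ℝ = 0)
    {W : Set (ℝ × EuclideanSpace ℝ (Fin 3))} (hW : IsOpen W) (hWs : W ⊆ Set.Iio (0 : ℝ) ×ˢ Set.univ)
    (hnd : ∀ z ∈ W, fderiv ℝ (v z.1) z.2 (EuclideanSpace.single 0 1) 2 ≠ 0 ∨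
      fderiv ℝ (v z.1) z.2 (EuclideanSpace.single 1 1) 2 ≠ 0)
    (hhyp : ∀ z ∈ W,
      fderiv ℝ (v z.1) z.2 (EuclideanSpace.single 2 1) 0 * fderiv ℝ (v z.1) z.2 (EuclideanSpace.single 0 1) 2 +
        fderiv ℝ (v z.1) z.2 (EuclideanSpace.single 2 1) 1 * fderiv ℝ (v z.1) z.2 (EuclideanSpace.single 1 1) 2 < 0)
    (hthick : ∀ m : ℝ → ℝ → ℝ, ∀ W₁ : Set (ℝ × EuclideanSpace ℝ (Fin 3)), W₁ ⊆ W → IsOpen W₁ → W₁.Nonempty →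
      ∃ z ∈ W₁, ∃ b : Fin 3, b ≠ 2 ∧
        fderiv ℝ (v z.1) z.2 (EuclideanSpace.single 2 1) b ≠
          m z.1 (z.2 2) * fderiv ℝ (v z.1) z.2 (EuclideanSpace.single b 1) 2)
    {z₀ : ℝ × EuclideanSpace ℝ (Fin 3)} (hz₀ : z₀ ∈ W)
    (hall : ∀ z ∈ W, Dense {y : EuclideanSpace ℝ (Fin 3) |
        fderiv ℝ (v z.1) y (EuclideanSpace.single 2 1) 0 * fderiv ℝ (v z.1) y (EuclideanSpace.single 0 1) 2 +
          fderiv ℝ (v z.1) y (EuclideanSpace.single 2 1) 1 * fderiv ℝ (v z.1) y (EuclideanSpace.single 1 1) 2 < 0} →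
      ∀ b : Fin 3, b ≠ 2 → ∀ x p : EuclideanSpace ℝ (Fin 3),
        fderiv ℝ (v z.1) x (EuclideanSpace.single b 1) 2 *
            fderiv ℝ (fun y => fderiv ℝ (v z.1) y (EuclideanSpace.single 2 1) b) x p -
          fderiv ℝ (v z.1) x (EuclideanSpace.single 2 1) b *
            fderiv ℝ (fun y => fderiv ℝ (v z.1) y (EuclideanSpace.single b 1) 2) x p = 0) :
    ∃ W' : Set (ℝ × EuclideanSpace ℝ (Fin 3)), W' ⊆ W ∧ IsOpen W' ∧ W'.Nonempty ∧
      ∀ z ∈ W', ¬ Dense {y : EuclideanSpace ℝ (Fin 3) |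
        fderiv ℝ (v z.1) y (EuclideanSpace.single 2 1) 0 * fderiv ℝ (v z.1) y (EuclideanSpace.single 0 1) 2 +
          fderiv ℝ (v z.1) y (EuclideanSpace.single 2 1) 1 * fderiv ℝ (v z.1) y (EuclideanSpace.single 1 1) 2 < 0} := by
  -- a product ball round `z₀` inside the window
  obtain ⟨r, hr, hball⟩ := Metric.isOpen_iff.1 hW z₀ hz₀
  have hprod : ball z₀.1 r ×ˢ ball z₀.2 r ⊆ W := by
    rw [ball_prod_same, Prod.mk.eta]; exact hball
  -- the (TH)-instants near `z₀.1` are isolated (thickness + joint analyticity in time)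
  have hev := th_instants_isolated_of_class C v hrate hcont hmild hdiv hpol hWs hnd hthick hr hr hprod (mem_ball_self hr)
  rw [eventually_nhdsWithin_iff, Metric.eventually_nhds_iff] at hev
  obtain ⟨ε, hε, hεP⟩ := hev
  -- the sub-window `(t₀, t₀ + ε') × B`
  set ε' : ℝ := min ε r with hε'
  have hε'pos : 0 < ε' := lt_min hε hr
  refine ⟨Set.Ioo z₀.1 (z₀.1 + ε') ×ˢ ball z₀.2 r, ?_, isOpen_Ioo.prod isOpen_ball,
    ⟨(z₀.1 + ε' / 2, z₀.2), Set.mk_mem_prod ⟨by linarith, by linarith⟩ (mem_ball_self hr)⟩, ?_⟩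
  · -- it lies inside the product ball, hence inside `W`
    refine Set.Subset.trans (Set.prod_mono (fun s hs => ?_) le_rfl) hprod
    rw [Metric.mem_ball, Real.dist_eq, abs_lt]
    constructor <;> linarith [hs.1, hs.2, min_le_right ε r]
  · -- none of its times is densely hyperbolic
    intro z hz hDz
    obtain ⟨hs, hy⟩ := Set.mem_prod.1 hz
    have hzW : z ∈ W := hprod (Set.mk_mem_prod (by
      rw [Metric.mem_ball, Real.dist_eq, abs_lt]
      constructor <;> linarith [hs.1, hs.2, min_le_right ε r]) hy)
    have ht : z.1 < 0 := (Set.mem_prod.1 (hWs hzW)).1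
    -- the time `z.1` is punctured-close to `z₀.1`, hence NOT constant-slope on the ball
    have hP := hεP (by
      rw [Real.dist_eq, abs_lt]
      constructor <;> linarith [hs.1, hs.2, min_le_left ε r]) (by
      show z.1 ∈ ({z₀.1}ᶜ : Set ℝ)
      exact fun h => by simp only [Set.mem_singleton_iff] at h; linarith [hs.1])
    -- but its slice is densely hyperbolic, so its defect vanishes identically (case hypothesis) and the slope IS globally constant
    have hN := hall z hzW hDz
    have han : AnalyticOnNhd ℝ (v z.1) univ :=
      analyticOnNhd_slice hcont (bdd_of_hasTypeITimeDecay hrate) hmild ht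
    obtain ⟨c, -, hc⟩ := constSlope_of_gnDefect_eq_zero han
      (fun y => wedge_slice_of_class hrate hcont hmild hdiv hpol ht y) hN ⟨z.2, hhyp z hzW⟩
    exact hP ⟨c, fun x _ b hb => hc x b hb⟩

end Summit.NavierStokesRegularity.NavierStokesRegularity.Theorems.PoloidalWindowDoorPoloidalWindowRigidityZShockThInstantAbsorbed
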